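import Summits.Ventures.QEC.Census.CertCheckBZBridge
import HarnessLib

/-!
# Soundness of the Brouwer–Zimmermann branch of the CSS distance-certificate checker
# (plan/CERT-FORMAT.md v1.1 §4 L1/L5/L7, §5.3; census/search-1/BZ-CHECKER-SPEC.md §L "Use" + "Assembly")

With the bridge lemmas of `Census/CertCheckBZBridge.lean` (each Bool check of `Census/CertCheckBZ.lean` discharges
one hypothesis of type-07's `Census/BZAssembly.lean`), this file assembles:

* `block_sound` — ONE BLOCK (`bz_block`): structural data of the side (type-02's rank certificates, the pairing
  `logOK` and L1 = `Census/CertLogical.lean`'s `exists_coeffs_of_ker`, `n = r_syn + r_stab + k`), the allow-list,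
  `blockOK` with target `≤ wmax + 1` and the row-count check ⇒ every non-trivial logical whose label lies in
  `span W_b` has weight `≥ target`;
* `bz_lower_sound` — ONE SIDE (`bz_cover_of_blocks` + type-06's parity lemma `Census/CertParity.lean` when an
  `evenWitness` is present): `bzStructOK`, `bzLenOK` and every block chunk ⇒ every `z ∈ ker Hsyn ∖ rowspace Hstab`
  has weight `> wmax`;
* `DistCert.dZ_code_of_bz` / `dX_code_of_bz` — for a `DistCert c` with `BZData z`:
  `c.checkStructure = true → c.bzZStruct z = true → c.bzZLen z = true → (∀ b < |blocks|, c.bzZBlock z b = true) →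
  (c.code _).dZ = c.dZ`, each hypothesis one `decide` (tier KERNEL) or `native_decide` (tier COMPILED), chunk key
  (side, block) (CERT-FORMAT §7);
* control: the Steane code's `bz` certificate (cert/examples/steane7-bz.certA.json) gives `d_Z = d_X = 3`, KERNEL.

HONEST FRAMING: the checker never trusts the certificate's producer — blocks, matrices, bounds and the enumeration
are re-derived from the shipped data; no distance VALUE is asserted in this file except the Steane control.
-/

namespace Summit.Ventures.QEC.Census

open Matrix Finset Literature.InformationTheory.QuantumCodes Literature.InformationTheory.Coding

/-! ## One block: discharge of `bz_block` -/

section Block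

variable {n : ℕ} {Hsyn Hstab : List ℕ} {rcY rcS : RankCert} {L Ld : List ℕ} {found : List (ℕ × List ℕ)}

/-- The dual (label) matrix of a side: row `j` = the word `Ld[j]`. -/
def ldMat (n : ℕ) (L Ld : List ℕ) : Matrix (Fin L.length) (Fin n) (ZMod 2) := fun j => ofBits n (Ld.getD j 0)

/-- **One block** (BZ-CHECKER-SPEC C3 + C4 ⇒ L5 "Use"): if the side's structural data checks (rank certificates,
pairing, dimension), the allow-list decomposes, `blockOK` passes for block `blk` with target `≤ wmax + 1` and every
matrix has `kb = |G_b|` rows, then every non-trivial logical whose label lies in `span W_blk` has weight `≥ target`.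
Discharges type-07's `bz_block` hypothesis by hypothesis. -/
theorem block_sound (hn : 0 < n) (hcomm : rowMatrix n Hsyn * (rowMatrix n Hstab)ᵀ = 0)
    (hY : rcY.check n Hsyn = true) (hS : rcS.check n Hstab = true) (hL : logOK n Hsyn Hstab L Ld = true)
    (hdim : n = rcY.r + rcS.r + L.length) (hfound : foundOK Hstab found = true) {wmax target : ℕ}
    (htw : target ≤ wmax + 1) (blk : BZBlock)
    (hblk : blockOK n wmax target (found.map Prod.fst) (gbRows Hstab rcS L blk) blk = true)
    (hlen : (blk.mats.all fun mt => mt.A.length == (gbRows Hstab rcS L blk).length) = true)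
    {z : Fin n → ZMod 2} (hz : rowMatrix n Hsyn *ᵥ z = 0) (hz' : z ∉ rowSpace (rowMatrix n Hstab))
    (hlab : ldMat n L Ld *ᵥ z ∈
      Submodule.span (ZMod 2) (Set.range fun l : Fin blk.W.length => ofBits L.length blk.W[l])) :
    target ≤ hammingNorm z := by
  rcases Nat.eq_zero_or_pos target with h0 | htpos
  · omega
  -- unpack the block checks
  simp only [blockOK, Bool.and_eq_true, List.all_eq_true, decide_eq_true_eq] at hblk
  obtain ⟨hmats, hbd⟩ := hblk
  simp only [List.all_eq_true, beq_iff_eq] at hlen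
  set Gb := gbRows Hstab rcS L blk with hGb
  have hmat : ∀ i : Fin blk.mats.length, matrixOK n wmax (found.map Prod.fst) Gb (blk.mats[i]) = true :=
    fun i => hmats _ (List.getElem_mem i.2)
  have hAlen : ∀ i : Fin blk.mats.length, (giRows Gb (blk.mats[i])).length = Gb.length := fun i => by
    rw [giRows, List.length_map]
    exact hlen _ (List.getElem_mem i.2)
  have hsysOK : ∀ i : Fin blk.mats.length, systematicOK n (giRows Gb (blk.mats[i])) (blk.mats[i]).T = true :=
    fun i => by
      have := hmat i
      simp only [matrixOK, Bool.and_eq_true] at this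
      exact this.1.1
  have hTlen : ∀ i : Fin blk.mats.length, (blk.mats[i]).T.length = Gb.length := fun i => by
    have := hsysOK i
    simp only [systematicOK, Bool.and_eq_true, beq_iff_eq] at this
    rw [← this.1.1, hAlen i]
  have hTlt : ∀ (i : Fin blk.mats.length) (q : ℕ), q ∈ (blk.mats[i]).T → q < n := fun i q hq => by
    have := hsysOK i
    simp only [systematicOK, Bool.and_eq_true, List.all_eq_true, decide_eq_true_eq] at this
    exact this.1.2 q hq
  -- the CSS code of the side
  let C := CSSCode.ofMatrices (rowMatrix n Hsyn) (rowMatrix n Hstab) hcomm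
  have hlt := bz_block C (L := logVec n L) (Ld := ldMat n L Ld)
    (fun j => mulVec_dual_eq_zero hL j) (fun i j => dual_dotProduct_logVec hL i j)
    (fun w hw => exists_coeffs_of_ker hcomm hY hS hL hdim hw)
    (kb := Gb.length) (Gb := fun j => rowMatrix n Gb j)
    (by rw [← rowSpace_rowMatrix_eq_span]; exact rowSpace_le_span_gbRows hS L blk)
    (W := fun l : Fin blk.W.length => ofBits L.length blk.W[l])
    (fun l => by rw [← rowSpace_rowMatrix_eq_span]; exact sum_smul_logVec_mem_span_gbRows n Hstab rcS L blk l)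
    (m := blk.mats.length) (G := fun i => rowFun n (giRows Gb (blk.mats[i])) Gb.length)
    (T := fun i => colFun hn (blk.mats[i]).T Gb.length)
    (fun i j j' => hsys_of_systematicOK hn (hsysOK i) (hTlen i) j j')
    (fun i j => by rw [← rowSpace_rowMatrix_eq_span]; exact rowFun_giRows_mem Gb _ _ j)
    (t := fun i => (blk.mats[i]).t) (wmax := target - 1)
    (fun i a ha1 hat haw => henum_of_matrixOK hfound (hmat i) (hAlen i) a ha1 hat (le_trans haw (by omega)))
    (by rw [← bzBoundList_eq_bzBound hn hTlt hTlen]; omega)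
    hz hz' hlab
  omega

end Block

/-! ## One side: discharge of `bz_cover_of_blocks` (+ parity) -/

section Side

variable {n : ℕ} {Hsyn Hstab : List ℕ} {rcY rcS : RankCert} {L Ld : List ℕ} {found : List (ℕ × List ℕ)}
  {wmax : ℕ} {s : BZSide}

/-- The parity-adjusted threshold never exceeds `wmax`. -/
theorem wEff_le (wmax : ℕ) (ew : Option (List ℕ)) : wEff wmax ew ≤ wmax := by
  unfold wEff; split <;> omega

/-- **One side, method `bz`** (BZ-CHECKER-SPEC §L Assembly): the structural check, the row-count check and every
block chunk give the lower half of a side certificate — every `z ∈ ker Hsyn ∖ rowspace Hstab` has weight `> wmax`.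
(The upper witness and the allow-list decomposition live in `checkStructure`.) -/
theorem bz_lower_sound (hcomm : rowMatrix n Hsyn * (rowMatrix n Hstab)ᵀ = 0) (hfound : foundOK Hstab found = true)
    (hst : bzStructOK n Hsyn Hstab rcY rcS L Ld s = true) (hlen : bzLenOK Hstab rcS L s = true)
    (hb : ∀ b : ℕ, b < s.blocks.length → bzBlockOK n Hstab rcS L wmax (found.map Prod.fst) s b = true)
    (w : Fin n → ZMod 2) (hw : rowMatrix n Hsyn *ᵥ w = 0) (hw' : w ∉ rowSpace (rowMatrix n Hstab)) :
    wmax < hammingNorm w := by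
  rcases Nat.eq_zero_or_pos n with hn0 | hn
  · subst hn0
    exfalso
    apply hw'
    have : w = 0 := funext fun i => i.elim0
    rw [this]
    exact Submodule.zero_mem _
  simp only [bzStructOK, Bool.and_eq_true, beq_iff_eq, List.all_eq_true, decide_eq_true_eq] at hst
  obtain ⟨⟨⟨⟨⟨⟨⟨hY, hS⟩, hL⟩, hdim⟩, -⟩, -⟩, hpar⟩, hcov⟩ := hst
  simp only [bzLenOK, List.all_eq_true] at hlen
  let C := CSSCode.ofMatrices (rowMatrix n Hsyn) (rowMatrix n Hstab) hcomm
  -- every block: logicals with label in span W_b have weight > wEff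
  have hblock : ∀ (b : Fin s.blocks.length) (z : Fin n → ZMod 2), rowMatrix n Hsyn *ᵥ z = 0 →
      z ∉ rowSpace (rowMatrix n Hstab) → ldMat n L Ld *ᵥ z ∈
        ((Submodule.span (ZMod 2) (Set.range fun l : Fin (s.blocks[b]).W.length =>
          ofBits L.length (s.blocks[b]).W[l]) : Submodule (ZMod 2) (Fin L.length → ZMod 2)) : Set _) →
      wEff wmax s.evenWitness < hammingNorm z := by
    intro b z hz hz' hlab
    have hbb := hb b b.2
    simp only [bzBlockOK, List.getElem?_eq_getElem b.2] at hbb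
    have hlenb : ((s.blocks[b]).mats.all fun mt => mt.A.length == (gbRows Hstab rcS L (s.blocks[b])).length) = true := by
      rw [List.all_eq_true]
      exact hlen _ (List.getElem_mem b.2)
    have := block_sound hn hcomm hY hS hL hdim hfound (Nat.succ_le_succ (wEff_le wmax s.evenWitness))
      (s.blocks[b]) hbb hlenb hz hz' hlab
    omega
  have key : wEff wmax s.evenWitness < hammingNorm w :=
    bz_cover_of_blocks C (L := logVec n L) (Ld := ldMat n L Ld) (fun j => mulVec_dual_eq_zero hL j)
      (fun i j => dual_dotProduct_logVec hL i j) (fun z hz => exists_coeffs_of_ker hcomm hY hS hL hdim hz)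
      (fun b : Fin s.blocks.length => ((Submodule.span (ZMod 2) (Set.range fun l : Fin (s.blocks[b]).W.length =>
          ofBits L.length (s.blocks[b]).W[l]) : Submodule (ZMod 2) (Fin L.length → ZMod 2)) : Set _))
      hblock (fun lam hlam => exists_block_of_coverOK hcov lam hlam) hw hw'
  -- parity upgrade
  cases hew : s.evenWitness with
  | none => simpa [wEff, hew] using key
  | some sel =>
    rw [hew] at key hpar
    simp only [parityPartOK] at hpar
    exact lt_hammingNorm_of_even C (fun z hz => even_hammingNorm_of_parityOK hpar hz) hw
      (by simpa [wEff] using key)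

end Side

/-! ## The checker: `d_Z`, `d_X` of a certified code by method `bz` -/

namespace DistCert

variable (c : DistCert) (z : BZData)

/-- **Soundness, `Z` side, method `bz`**: the structural check of the `DistCert` (commutation, upper witnesses,
allow-list decompositions), the `bz` structural check, the row-count check and every `Z` block chunk give
`d_Z = c.dZ` for the certificate's code. Each hypothesis is one `decide` / `native_decide`. -/
theorem dZ_code_of_bz (hs : c.checkStructure = true) (hst : c.bzZStruct z = true) (hlen : c.bzZLen z = true)
    (hb : ∀ b : ℕ, b < z.sideZ.blocks.length → c.bzZBlock z b = true) :
    (c.code (c.commOK_of_checkStructure hs)).dZ = c.dZ := by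
  have h' := hs
  simp only [checkStructure, Bool.and_eq_true] at h'
  obtain ⟨hv, hv', hwt⟩ := upper_sound h'.1.1.1.2
  refine (c.code _).dZ_eq_of_witness hv hv' hwt fun w hw hw' => ?_
  have := bz_lower_sound (comm_of_commOK (c.commOK_of_checkStructure hs)) h'.1.1.2 hst hlen hb w hw hw'
  omega

/-- **Soundness, `X` side, method `bz`** (roles of `H^X`, `H^Z` exchanged). -/
theorem dX_code_of_bz (hs : c.checkStructure = true) (hst : c.bzXStruct z = true) (hlen : c.bzXLen z = true)
    (hb : ∀ b : ℕ, b < z.sideX.blocks.length → c.bzXBlock z b = true) :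
    (c.code (c.commOK_of_checkStructure hs)).dX = c.dX := by
  have h' := hs
  simp only [checkStructure, Bool.and_eq_true] at h'
  obtain ⟨hv, hv', hwt⟩ := upper_sound h'.1.2
  refine (c.code _).dX_eq_of_witness hv hv' hwt fun w hw hw' => ?_
  have := bz_lower_sound ((c.code (c.commOK_of_checkStructure hs)).HZ_mul_HX_transpose) h'.2 hst hlen hb w hw hw'
  omega

end DistCert

/-! ## Control: Steane by `bz`, tier KERNEL -/

/-- `d_Z = 3` for the Steane code through the Brouwer–Zimmermann checker (cert/examples/steane7-bz.certA.json). -/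
theorem dZ_certSteane7_bz : (certSteane7.code (certSteane7.commOK_of_checkStructure (by decide))).dZ = 3 :=
  certSteane7.dZ_code_of_bz bzSteane (by decide) (by decide) (by decide)
    (fun b hb => by change b < 1 at hb; interval_cases b; decide)

/-- `d_X = 3` for the Steane code through the Brouwer–Zimmermann checker. -/
theorem dX_certSteane7_bz : (certSteane7.code (certSteane7.commOK_of_checkStructure (by decide))).dX = 3 :=
  certSteane7.dX_code_of_bz bzSteane (by decide) (by decide) (by decide)
    (fun b hb => by change b < 1 at hb; interval_cases b; decide)

end Summit.Ventures.QEC.Census
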